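import Summits.Ventures.QEC.CircuitDistance.ETowerZeroMini345XD
import HarnessLib

/-!
# #345 X tower, level C by the (α) MINI-TOWER — CERTIFICATES, file 1 of 2: base block 0 (ZERO-CERT §2; consumers `ETowerZeroBand.kerD_of_ZT` / `zeroD_of_ZT`)
(cell `qec`, experiment CDX; emitter idea-1 g5 `emit_mini345.py`)

* MINI BASE (plain table `cu3`, 45 slots, words of weight ≤ 5): for every block `b < 5` (anchor `a = 9b`) and every number `k < 5` of further
  slots ONE fact `zb3_b<b>_k<k> : zl k cu3 (matchedH 3 3 5 31 T3B) (cu3 a) (2^a) (a+1) 45 = true` (230801 anchored leaves in all, every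
  kernel leaf matched in its bucket of `T3B`); the heavy item `(0,4)` is split by the outer slot into bands `zbandK 4 …` + a `bandCover`;
* MINI ZERO FIBRES (h′ = 2 since W′ = 5): step A′ `zmA_b<b>_k<k> : zl k Mu2 (matchedB 3 3 5 DpA) (Mu2 a) (2^a) (a+1) 45` (a = 9b, k < 2) and
  step B′ `zmB_b<b>_k<k> : zl k Mu1 (matchedB 6 3 5 DpB) (Mu1 a) (2^a) (a+1) 90` (a = 18b, k < 2).
`decide +kernel` only; nothing here asserts a value of `d_circ`.
-/

set_option maxRecDepth 100000
set_option exponentiation.threshold 1024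
set_option linter.unusedVariables false

namespace Summit.Ventures.QEC.CircuitDistance.ETower.Sec345X.Zeros

open Summit.Ventures.QEC.Census Summit.Ventures.QEC.Census.Fold Summit.Ventures.QEC.CircuitDistance.ETower

set_option maxHeartbeats 400000000 in
/-- MINI BASE certificate, block 0 (anchor 0), 0 further slots: 1 leaves. -/
theorem zb3_b0_k0 : zl 0 cu3 (matchedH 3 3 5 31 T3B) (cu3 0) (2 ^ 0) 1 45 = true := by
  decide +kernel

set_option maxHeartbeats 400000000 in
/-- MINI BASE certificate, block 0 (anchor 0), 1 further slots: 44 leaves. -/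
theorem zb3_b0_k1 : zl 1 cu3 (matchedH 3 3 5 31 T3B) (cu3 0) (2 ^ 0) 1 45 = true := by
  decide +kernel

set_option maxHeartbeats 400000000 in
/-- MINI BASE certificate, block 0 (anchor 0), 2 further slots: 946 leaves. -/
theorem zb3_b0_k2 : zl 2 cu3 (matchedH 3 3 5 31 T3B) (cu3 0) (2 ^ 0) 1 45 = true := by
  decide +kernel

set_option maxHeartbeats 400000000 in
/-- MINI BASE certificate, block 0 (anchor 0), 3 further slots: 13244 leaves. -/
theorem zb3_b0_k3 : zl 3 cu3 (matchedH 3 3 5 31 T3B) (cu3 0) (2 ^ 0) 1 45 = true := by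
  decide +kernel

set_option maxHeartbeats 400000000 in
/-- MINI BASE certificate, block 0 (anchor 0), 4 further slots, BAND outer slot ∈ [1,38): 66045 leaves. -/
theorem zb3_b0_k4_i1_38 : zbandK 4 cu3 (matchedH 3 3 5 31 T3B) (cu3 0) (2 ^ 0) 1 1 38 = true := by
  decide +kernel

set_option maxHeartbeats 400000000 in
/-- MINI BASE certificate, block 0 (anchor 0), 4 further slots, BAND outer slot ∈ [38,45): 69706 leaves. -/
theorem zb3_b0_k4_i38_45 : zbandK 4 cu3 (matchedH 3 3 5 31 T3B) (cu3 0) (2 ^ 0) 1 38 45 = true := by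
  decide +kernel

/-- band cover, mini base block 0 k 4. -/
theorem covb3_b0_k4 : bandCover 1 45 [(1, 38), (38, 45)] = true := by decide

end Summit.Ventures.QEC.CircuitDistance.ETower.Sec345X.Zeros
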